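import Summits.RiemannHypothesis.RiemannHypothesis.Theorems.WeilTwoPrimeDeflE72Base
import Summits.RiemannHypothesis.RiemannHypothesis.Theorems.WeilTwoPrimeDeflE72DataPE23
import Literature.NumberTheory.LFunctions.WeilBlockRowsPZ
import Literature.NumberTheory.LFunctions.WeilBlockRowsFast
import Summits.RiemannHypothesis.RiemannHypothesis.Theorems.WeilTwoPrimeDeflE72DataDnE12
import HarnessLib

/-!
# Deflated two-prime certificate E72: dominance of rows 126–127 of `R = S''_even(κ') − UᵀU` (factored data)

`WeilCert.checkDomRowPZ` with the materialized augmented block, the factored inverse `weilCertDeflE72DnE/weilCertDeflE72LsE` and the Bessel block, by `decide +kernel` row by row. Pure proof file.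
-/

noncomputable section

namespace Summit.RiemannHypothesis.RiemannHypothesis.Theorems.EvenWinsBeyondArch

open Literature.NumberTheory.LFunctions

set_option maxHeartbeats 0 in
/-- Kernel check of the dominance of row 126 of `R` (even block, certificate E72). [folklore] -/
theorem checkDomRowF0_126_weilCertDeflE72 :
    weilCertDeflE72Base.checkDomRowF weilCertDeflE72PmE weilCertDeflE72DnE weilCertDeflE72LsE weilCertDeflE72HpE weilCertDeflE72Kappa' 0 126 = true := by
  decide +kernel

/-- Kernel check of the dominance of row 126 of `R` (factored data), from the fast row. [folklore] -/
theorem checkDomRowPZ0_126_weilCertDeflE72 :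
    weilCertDeflE72Base.checkDomRowPZ weilCertDeflE72PmE weilCertDeflE72DnE weilCertDeflE72LsE weilCertDeflE72HpE weilCertDeflE72Kappa' 0 126 = true :=
  WeilCert.checkDomRowPZ_of_F (by decide) checkDomRowF0_126_weilCertDeflE72

set_option maxHeartbeats 0 in
/-- Kernel check of the dominance of row 127 of `R` (even block, certificate E72). [folklore] -/
theorem checkDomRowF0_127_weilCertDeflE72 :
    weilCertDeflE72Base.checkDomRowF weilCertDeflE72PmE weilCertDeflE72DnE weilCertDeflE72LsE weilCertDeflE72HpE weilCertDeflE72Kappa' 0 127 = true := by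
  decide +kernel

/-- Kernel check of the dominance of row 127 of `R` (factored data), from the fast row. [folklore] -/
theorem checkDomRowPZ0_127_weilCertDeflE72 :
    weilCertDeflE72Base.checkDomRowPZ weilCertDeflE72PmE weilCertDeflE72DnE weilCertDeflE72LsE weilCertDeflE72HpE weilCertDeflE72Kappa' 0 127 = true :=
  WeilCert.checkDomRowPZ_of_F (by decide) checkDomRowF0_127_weilCertDeflE72


end Summit.RiemannHypothesis.RiemannHypothesis.Theorems.EvenWinsBeyondArch
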